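import Summits.CriticalPhenomena.PercolationContinuityZ3.Theses.PercNonProliferation
import Summits.CriticalPhenomena.PercolationContinuityZ3.Theses.PercFiniteBoxLRO
import Summits.CriticalPhenomena.PercolationContinuityZ3.Theorems.PercShatteringRaceNearLinearTwoClusterDecayCritFrontier
import Summits.CriticalPhenomena.PercolationContinuityZ3.Theorems.PercShatteringRaceRaceLemma
import Summits.CriticalPhenomena.PercolationContinuityZ3.Theorems.PercNonProliferationNonProliferationFewClassesRatioFree
import Summits.CriticalPhenomena.PercolationContinuityZ3.Theorems.PercShatteringRaceJumpUniquenessBoxLRO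
import HarnessLib

/-!
# Crux `PercNonProliferation.NonProliferation` (stmt-CriticalPhenomena-4444), line `jump-fragmentation` —
# the POLYNOMIAL-RATIO shadow of the load-bearing stub S1 `stub_infiniteClusterFewClasses`

Lead c9 of line `jump-fragmentation` (skeleton `Cruxes/NonProliferation/Lines/jump_fragmentation.lean`).
Lands with `--supports stmt-CriticalPhenomena-4444`; closes nothing by itself. No definitions.

The registered stub S1 asks, at `p_c(ℤ³)`, for few `B(2n)`-classes of the PERCOLATING points of `B(n)`
(LINEAR aspect ratio `2`, with probability `≥ c`, infinitely often). Lead c8 recorded where its content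
sits qualitatively (`tendsto_real_noTwoUnjoined_atTop`: for FIXED `n` the outer box `B(R)`, `R → ∞`,
makes the event almost sure — uniqueness only). This file is the quantitative companion: the outer box
may be taken POLYNOMIAL in the inner one, with `M = 1` and probability tending to one.

* `exists_twoArms_of_twoPercUnjoined` — deterministic core: two percolating points of `B(n)` unjoined
  inside `B(m) ⊇ B(n)` are two DISTINCT spanning representatives of `(B(n), B(m))` in the sense of the
  sibling crux `PercFiniteBoxLRO.CritBoxTwoArmsDecay` (an infinite open lattice path from each leaves
  `B(m)` through `∂ⁱⁿB(m)`, `exists_openConnIn_innerBoundary_of_percolatesAt`).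
* `real_twoPercUnjoined_le_real_twoArms` — hence `P(two percolating points of B(n) unjoined in B(m))
  ≤ P(two distinct clusters of B(m) from B(n) to ∂ⁱⁿB(m))` for `n ≤ m`, at every `p`.
* `tendsto_real_noTwoPercUnjoined_of_twoArms` — so along any outer scale `m(n) ≥ n` on which the
  two-distinct-clusters probability tends to `0`, S1's `M = 1` event has probability `→ 1`.
* `fewClassesPoly_above_48` — **UNCONDITIONAL**: for every `α > 48`,
  `P_{p_c(ℤ³)}(no two percolating points of B(n) unjoined inside B(⌈n^α⌉)) → 1` (bond Cerf 2015
  Thm 1.2 at `p_c`, in tree as `NearLinearTwoClusterDecay.CritFrontier.critBoxTwoArmsDecay_above_48`).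
* `fewClassesPoly_of_critBoxTwoArmsDecay` — **for every `α > 1` granted stmt-CriticalPhenomena-0859**
  (`PercFiniteBoxLRO.CritBoxTwoArmsDecay`): the same limit at every polynomial aspect ratio.
* `fewClassesPoly_frequently_above_48` — the unconditional statement in S1's own `∃ᶠ`/`c ≤ P` shape
  (`c = 1/2`, `M = 1`, outer box `B(⌈n^α⌉)`, `α > 48`).

What this calibrates (for the tenure planner who files S1 as an item). S1's d-free, p-free part is
uniqueness (c8, ratio-free); its unconditional quantitative part at `p_c(ℤ³)` reaches every polynomial
aspect `n ↦ ⌈n^α⌉`, `α > 48` (this file), and every `α > 1` exactly when the sibling crux 0859 holds;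
what is NOT covered by any existing item is the passage `α → 1`, i.e. the LINEAR ratio `B(n) ⊆ B(2n)`
(barriers `SameDensityLocalUniqueness` / `SprinklingRenormalisation`). So the S1 item-to-be is the
linear-ratio endpoint of the `CritBoxTwoArmsDecay` family restricted to percolating points — a placement /
dedup datum, not a proof strategy.
-/

noncomputable section

namespace Summit.CriticalPhenomena.PercolationContinuityZ3.Theorems.NonProliferation

open MeasureTheory Filter Topology
open Literature.Probability.LatticeModels Literature.Probability.Percolation

namespace FewClassesPoly

/-- **Deterministic core.** On a lattice configuration, two percolating points of `B(n)` that are not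
joined inside `B(m)`, `n ≤ m`, are two distinct spanning representatives of `(B(n), B(m))`: each is joined
inside `B(m)` to a point of `∂ⁱⁿB(m)` (first exit of an infinite open path), and they are not joined to
each other inside `B(m)`. [folklore] -/
theorem exists_twoArms_of_twoPercUnjoined {n m : ℕ} (hnm : n ≤ m) {ω : BondConfig (Site 3)}
    (hω : ω ⊆ (zdGraph 3).edgeSet)
    (h : ∃ x : Fin (1 + 1) → Site 3, (∀ i, x i ∈ box 3 n) ∧ (∀ i, ω ∈ percolatesAt (x i)) ∧
      ∀ i j, i ≠ j → ω ∉ openConnIn (↑(box 3 m) : Set (Site 3)) (x i) (x j)) :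
    ∃ x ∈ box 3 n, ∃ x' ∈ box 3 n, ∃ y ∈ innerBoundary (zdGraph 3) (box 3 m),
      ∃ y' ∈ innerBoundary (zdGraph 3) (box 3 m),
        ω ∈ openConnIn (↑(box 3 m) : Set (Site 3)) x y ∧ ω ∈ openConnIn (↑(box 3 m) : Set (Site 3)) x' y' ∧
          ω ∉ openConnIn (↑(box 3 m) : Set (Site 3)) x x' := by
  obtain ⟨x, hxbox, hperc, hbad⟩ := h
  obtain ⟨y, hy, hxy⟩ := exists_openConnIn_innerBoundary_of_percolatesAt
    (box_mono 3 hnm (hxbox 0)) hω (hperc 0)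
  obtain ⟨y', hy', hxy'⟩ := exists_openConnIn_innerBoundary_of_percolatesAt
    (box_mono 3 hnm (hxbox 1)) hω (hperc 1)
  exact ⟨x 0, hxbox 0, x 1, hxbox 1, y, hy, y', hy', hxy, hxy', hbad 0 1 (by decide)⟩

/-- **Comparison of probabilities** (every `p`, `n ≤ m`): `P_p(two percolating points of B(n) unjoined
inside B(m)) ≤ P_p(two distinct clusters of B(m) joining B(n) to ∂ⁱⁿB(m))` — the latter being the event of
`PercFiniteBoxLRO.CritBoxTwoArmsDecay` at the pair of scales `(n, m)`. [folklore] -/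
theorem real_twoPercUnjoined_le_real_twoArms (p : unitInterval) {n m : ℕ} (hnm : n ≤ m) :
    (bondPercolation (zdGraph 3) p).real
        {ω | ∃ x : Fin (1 + 1) → Site 3, (∀ i, x i ∈ box 3 n) ∧ (∀ i, ω ∈ percolatesAt (x i)) ∧
          ∀ i j, i ≠ j → ω ∉ openConnIn (↑(box 3 m) : Set (Site 3)) (x i) (x j)} ≤
      (bondPercolation (zdGraph 3) p).real
        {ω | ∃ x ∈ box 3 n, ∃ x' ∈ box 3 n, ∃ y ∈ innerBoundary (zdGraph 3) (box 3 m),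
          ∃ y' ∈ innerBoundary (zdGraph 3) (box 3 m),
            ω ∈ openConnIn (↑(box 3 m) : Set (Site 3)) x y ∧ ω ∈ openConnIn (↑(box 3 m) : Set (Site 3)) x' y' ∧
              ω ∉ openConnIn (↑(box 3 m) : Set (Site 3)) x x'} :=
  DCT16.real_mono_of_forall_subset_edgeSet (zdGraph 3) p fun _ hω h =>
    exists_twoArms_of_twoPercUnjoined hnm hω h

/-- **Squeeze.** Along any outer scale `m(n) ≥ n` on which the two-distinct-clusters probability of
`(B(n), B(m n))` tends to `0`, the probability that NO two percolating points of `B(n)` are unjoined inside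
`B(m n)` tends to `1` (every `p`). [folklore] -/
theorem tendsto_real_noTwoPercUnjoined_of_twoArms (p : unitInterval) {m : ℕ → ℕ} (hm : ∀ n, n ≤ m n)
    (h : Tendsto (fun n : ℕ => (bondPercolation (zdGraph 3) p).real
        {ω | ∃ x ∈ box 3 n, ∃ x' ∈ box 3 n, ∃ y ∈ innerBoundary (zdGraph 3) (box 3 (m n)),
          ∃ y' ∈ innerBoundary (zdGraph 3) (box 3 (m n)),
            ω ∈ openConnIn (↑(box 3 (m n)) : Set (Site 3)) x y ∧
              ω ∈ openConnIn (↑(box 3 (m n)) : Set (Site 3)) x' y' ∧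
                ω ∉ openConnIn (↑(box 3 (m n)) : Set (Site 3)) x x'}) atTop (𝓝 0)) :
    Tendsto (fun n : ℕ => (bondPercolation (zdGraph 3) p).real
        {ω | ¬ ∃ x : Fin (1 + 1) → Site 3, (∀ i, x i ∈ box 3 n) ∧ (∀ i, ω ∈ percolatesAt (x i)) ∧
          ∀ i j, i ≠ j → ω ∉ openConnIn (↑(box 3 (m n)) : Set (Site 3)) (x i) (x j)}) atTop (𝓝 1) := by
  set μ : Measure (BondConfig (Site 3)) := bondPercolation (zdGraph 3) p with hμ
  -- the bad event's probability tends to `0` by comparison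
  have hbad : Tendsto (fun n : ℕ => μ.real
      {ω | ∃ x : Fin (1 + 1) → Site 3, (∀ i, x i ∈ box 3 n) ∧ (∀ i, ω ∈ percolatesAt (x i)) ∧
        ∀ i j, i ≠ j → ω ∉ openConnIn (↑(box 3 (m n)) : Set (Site 3)) (x i) (x j)}) atTop (𝓝 0) :=
    tendsto_of_tendsto_of_tendsto_of_le_of_le tendsto_const_nhds h
      (fun n => measureReal_nonneg) (fun n => real_twoPercUnjoined_le_real_twoArms p (hm n))
  -- complement
  have heq : ∀ n : ℕ, μ.real
      {ω | ¬ ∃ x : Fin (1 + 1) → Site 3, (∀ i, x i ∈ box 3 n) ∧ (∀ i, ω ∈ percolatesAt (x i)) ∧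
        ∀ i j, i ≠ j → ω ∉ openConnIn (↑(box 3 (m n)) : Set (Site 3)) (x i) (x j)} =
      1 - μ.real
      {ω | ∃ x : Fin (1 + 1) → Site 3, (∀ i, x i ∈ box 3 n) ∧ (∀ i, ω ∈ percolatesAt (x i)) ∧
        ∀ i j, i ≠ j → ω ∉ openConnIn (↑(box 3 (m n)) : Set (Site 3)) (x i) (x j)} := by
    intro n
    have hmeas := RatioFree.measurableSet_noTwoUnjoined (d := 3) n (m n)
    rw [← Set.compl_setOf] at hmeas ⊢
    rw [probReal_compl_eq_one_sub (MeasurableSet.of_compl hmeas)]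
  simp_rw [heq]
  simpa using tendsto_const_nhds.sub hbad

end FewClassesPoly

open FewClassesPoly

/-- **S1's polynomial-ratio shadow is a theorem above Cerf's exponent (UNCONDITIONAL).** At `p_c(ℤ³)`, for
every `α > 48`, the probability that no two percolating points of `B(n)` are unjoined inside `B(⌈n^α⌉)` tends
to `1` — bond Cerf 2015 Thm 1.2 at `p_c` (`NearLinearTwoClusterDecay.CritFrontier.critBoxTwoArmsDecay_above_48`) restricted to percolating points.
Registered lead-extra stub `fewClassesPoly_above_48` of line `jump-fragmentation`. [cite: Cerf2015, Thm 1.2] -/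
theorem fewClassesPoly_above_48 :
    ∀ α : ℝ, 48 < α → Filter.Tendsto (fun n : ℕ => (bondPercolation (zdGraph 3) (criticalProbI 3)).real
        {ω | ¬ ∃ x : Fin (1 + 1) → Site 3, (∀ i, x i ∈ box 3 n) ∧ (∀ i, ω ∈ percolatesAt (x i)) ∧
          ∀ i j, i ≠ j → ω ∉ openConnIn (↑(box 3 ⌈(n : ℝ) ^ α⌉₊) : Set (Site 3)) (x i) (x j)})
      Filter.atTop (nhds 1) :=
  fun α hα => tendsto_real_noTwoPercUnjoined_of_twoArms (criticalProbI 3)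
    (m := fun n : ℕ => ⌈(n : ℝ) ^ α⌉₊) (le_nat_ceil_rpow (by linarith))
    (NearLinearTwoClusterDecay.CritFrontier.critBoxTwoArmsDecay_above_48 α hα)

/-- **S1's polynomial-ratio shadow at EVERY `α > 1`, granted the sibling crux stmt-CriticalPhenomena-0859**
(`PercFiniteBoxLRO.CritBoxTwoArmsDecay`: at `p_c(ℤ³)` two distinct clusters of `B(⌈n^α⌉)` from `B(n)` to
`∂ⁱⁿB(⌈n^α⌉)` have probability `→ 0` for every `α > 1`): then for every `α > 1` the probability that no two
percolating points of `B(n)` are unjoined inside `B(⌈n^α⌉)` tends to `1`. The registered stub S1 is the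
linear-ratio endpoint (`B(2n)`) of this family, which 0859 does not reach. Registered lead-extra stub
`fewClassesPoly_of_critBoxTwoArmsDecay` of line `jump-fragmentation`. [folklore] -/
theorem fewClassesPoly_of_critBoxTwoArmsDecay :
    Summit.CriticalPhenomena.PercolationContinuityZ3.Theses.PercFiniteBoxLRO.CritBoxTwoArmsDecay →
    ∀ α : ℝ, 1 < α → Filter.Tendsto (fun n : ℕ => (bondPercolation (zdGraph 3) (criticalProbI 3)).real
        {ω | ¬ ∃ x : Fin (1 + 1) → Site 3, (∀ i, x i ∈ box 3 n) ∧ (∀ i, ω ∈ percolatesAt (x i)) ∧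
          ∀ i j, i ≠ j → ω ∉ openConnIn (↑(box 3 ⌈(n : ℝ) ^ α⌉₊) : Set (Site 3)) (x i) (x j)})
      Filter.atTop (nhds 1) := by
  intro h0859 α hα
  unfold Summit.CriticalPhenomena.PercolationContinuityZ3.Theses.PercFiniteBoxLRO.CritBoxTwoArmsDecay at h0859
  exact tendsto_real_noTwoPercUnjoined_of_twoArms (criticalProbI 3)
    (m := fun n : ℕ => ⌈(n : ℝ) ^ α⌉₊) (le_nat_ceil_rpow hα.le) (h0859 α hα)

/-- **The unconditional statement in S1's own shape** (`M = 1`, `c = 1/2`, frequently — indeed eventually —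
in `n`, outer box `B(⌈n^α⌉)` in place of `B(2n)`), for every `α > 48`. [cite: Cerf2015, Thm 1.2] -/
theorem fewClassesPoly_frequently_above_48 :
    ∀ α : ℝ, 48 < α → ∃ᶠ n : ℕ in Filter.atTop, (1 / 2 : ℝ) ≤ (bondPercolation (zdGraph 3) (criticalProbI 3)).real
        {ω | ¬ ∃ x : Fin (1 + 1) → Site 3, (∀ i, x i ∈ box 3 n) ∧ (∀ i, ω ∈ percolatesAt (x i)) ∧
          ∀ i j, i ≠ j → ω ∉ openConnIn (↑(box 3 ⌈(n : ℝ) ^ α⌉₊) : Set (Site 3)) (x i) (x j)} := by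
  intro α hα
  refine Eventually.frequently ?_
  have h := fewClassesPoly_above_48 α hα
  exact (h.eventually (eventually_ge_nhds (by norm_num : (1 / 2 : ℝ) < 1)))

end Summit.CriticalPhenomena.PercolationContinuityZ3.Theorems.NonProliferation

end
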